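import Literature.Geometry.Riemannian.HamiltonCurvatureODE
import HarnessLib

/-!
# Negative lemmas for crux `ChangGurskyYang` (stmt-SmoothPoincare4-10834), line `margerin-cone-hamilton-rails`,
# STUB 1 `stub_margerinPolynomial` — drefute gen 2 (refuter-drefute-stmt-SmoothPoincare4-10834-g2-0)

Three groups of kernel facts about the lead's stub (`Cruxes/ChangGurskyYang/Lines/margerin-cone-hamilton-rails.lean`,
`stub_margerinPolynomial`: for `0 ≤ c < 1/6` some `σ ∈ (0,1]` with `P₂ ≤ −σ·|𝒟|²·R'` on `margerinCone c`), all
DEF-FREE (the `let`s are verbatim the skeleton's `scal`, `pairing`, `rmNormSq`, `devNormSq`, `margerinP2`; Hamilton's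
field `(A²+BBᵀ+2A^#, AB+BC+2B^#, C²+BᵀB+2C^#)` is `Literature.Geometry.Riemannian.HamiltonODE.field`):

§A **The Bianchi trace identity `tr A = tr C` is load-bearing ON ITS OWN.** The triage / AsTyped witnesses
(`(1+K, 0, 1)`, `K` skew; `witA`) drop the SYMMETRY of `A` and keep `tr A = tr C`. Complementary fact: keep `A`, `C`
symmetric (even scalar) but drop `tr A = tr C` — on the family `p = (a·1, 0, b·1)` the field is `(3a²·1, 0, 3b²·1)` and
`P₂ = 54ab(a−b)²`, `|𝒟|² = (3/2)(a−b)²`, `WP = (a−b)²/(6(a+b)²)`, so the stub's inequality fails inside EVERY cone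
`c > 0` for every `σ ≥ 0` (weak pinching INCREASES along the ODE; `ρ = P₂/(|𝒟|²R') = 4ab/(a²+b²) → +2` at the axis).
Such triples are no curvature operators (Bianchi forces `tr A = tr C`); the lesson is that a certificate must CONSUME
the trace identity. `field_smul_one_pair`, `margerinP2_pos_without_traceEq`, `no_margerinMargin_without_traceEq`,
`stub_margerinPolynomial_false_without_traceEq`.

§B **Quantifier order and the size of the margin.** From the cylinder family `(1, t·1, 1)` (`P₂ = −72t²(1−t)²`; the
tightness bound `σ ≤ 2(1−t)²/(3+t²)` on the cone `c = t²/6` is drefute gen 1's `margerinMargin_le`,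
`MargerinMarginBound.lean`, re-derived here as PRIVATE lemmas only because that module was not yet built on the farm
when this file was checked): `no_uniform_margerinMargin` — no single `σ > 0` serves all `c < 1/6` (the order
`∀ c, ∃ σ` cannot be reversed; Margerin's `β₀(δ) → 2`, Lemma 9); `no_linear_margerinMargin` — for every `κ > 0` the
explicit choice `σ(c) = κ(1/6 − c)` FAILS near `c = 1/6`: the margin vanishes QUADRATICALLY, `σ*(c) ≈ (9/2)(1/6 − c)²`.
A reshape of STUB 1 with an explicit `σ(c)` must take it `O((1/6 − c)²)`.

§C **The `B`-odd part of `P₂`** (helper identity, ALL block triples): `P₂(A,−B,C) − P₂(A,B,C) = −48·(tr A + tr C)·det B`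
(`⟨B, B^#⟩ = 3 det B` and `HamiltonODE.reflectB_field_reflectB`). Since the cone and `|𝒟|²R'` are `B`-even, STUB 1 is
equivalent to the one-sided `P₂^{even} + 24·R·|det B| ≤ −σ|𝒟|²R'`: it suffices to certify the half-cone `det B ≥ 0` of
the printed field (`det B ≤ 0` for the tree's `blockB`, whose reaction carries `−2B^#`), and the sharp-margin orbit
`S³ × ℝ` (`B ∈ t·SO(3)`) is exactly where `det B` is maximal at fixed `‖B‖`. `margerinP2_reflectB_sub`.

Numerical context (kit j013247, attached to the item): an independent adversarial search finds
`sup_{margerinCone c} P₂/(|𝒟|²R') = −2(1−√(6c))²/(3+6c)` to `4e−15` for twelve apertures `c ∈ [.01, .1666]`, attained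
on the `S³×ℝ` orbit at `WP = c`; the same optimizer turns positive on every mutated problem (`c > 1/6`; symmetry dropped;
trace identity dropped), as §A and `MargerinMarginBound.margerinP2_pos_above_sixth` predict.

## References

* C. Margerin, *A sharp characterization of the smooth 4-sphere in curvature terms*, Comm. Anal. Geom. 6 (1998)
  21–65: Part I, p. 25, Prop. 4 (p. 27), Lemma 5 (p. 29), Lemma 9 (p. 34). [Margerin1998]
* R. S. Hamilton, *Four-manifolds with positive curvature operator*, J. Differential Geom. 24 (1986) 153–179,
  §6 p. 166 (block system; `tr A = tr C` from the Bianchi identity). [Hamilton1986]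
-/

noncomputable section

open scoped Matrix BigOperators
open Literature.Geometry.Riemannian

namespace Summit.SmoothPoincare4.SmoothPoincare4.Theorems.ChangGurskyYang.Negative

set_option linter.dupNamespace false

/-! ## §A The trace identity is load-bearing on its own -/

/-- `(t·1)^# = t²·1` for `3 × 3` matrices (cofactors are quadratic); local copy of
`sharp_smul_one_fin_three` of `MargerinMarginBound.lean`. [folklore] -/
private theorem sharp_smul_one3 (t : ℝ) :
    (t • (1 : Matrix (Fin 3) (Fin 3) ℝ)).sharp = (t ^ 2) • (1 : Matrix (Fin 3) (Fin 3) ℝ) := by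
  ext i j
  fin_cases i <;> fin_cases j <;>
    simp [Matrix.sharp, Matrix.adjugate_fin_three, Matrix.smul_apply] <;> ring

/-- **Hamilton's ODE on the pair-of-scalars family**: `field (a·1, 0, b·1) = (3a²·1, 0, 3b²·1)`
(`A² + 2A^# = a²·1 + 2a²·1`). [cite: Hamilton1986, §6, p. 166] -/
theorem field_smul_one_pair (a b : ℝ) :
    HamiltonODE.field (a • (1 : Matrix (Fin 3) (Fin 3) ℝ), (0 : Matrix (Fin 3) (Fin 3) ℝ),
        b • (1 : Matrix (Fin 3) (Fin 3) ℝ)) =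
      ((3 * a ^ 2) • (1 : Matrix (Fin 3) (Fin 3) ℝ), (0 : Matrix (Fin 3) (Fin 3) ℝ),
        (3 * b ^ 2) • (1 : Matrix (Fin 3) (Fin 3) ℝ)) := by
  simp only [HamiltonODE.field]
  rw [sharp_smul_one3, sharp_smul_one3]
  have h0 : (0 : Matrix (Fin 3) (Fin 3) ℝ).sharp = 0 := by simp [Matrix.sharp]
  rw [h0]
  refine Prod.ext ?_ (Prod.ext ?_ ?_)
  · ext i j
    fin_cases i <;> fin_cases j <;>
      simp [Matrix.smul_apply] <;> ring
  · simp
  · ext i j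
    fin_cases i <;> fin_cases j <;>
      simp [Matrix.smul_apply] <;> ring

/-- **Weak pinching INCREASES along Hamilton's ODE at symmetric triples violating the trace
identity, inside every cone**: for every `c > 0` the triple `((1+s)·1, 0, 1)`, `s = min 1 c`, is
symmetric with `R = 6 + 3s > 0`, `|𝒟|² = (3/2)s² ≤ c R²`, `tr A ≠ tr C`, and
`P₂ = 54(1+s)s² > 0`. [cite: Margerin1998, Part I, Prop. 4] -/
theorem margerinP2_pos_without_traceEq (c : ℝ) (hc : 0 < c) :
    ∃ p : HamiltonODE.Blocks,
      let q : HamiltonODE.Blocks := HamiltonODE.field p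
      let scal : ℝ := p.1.trace + p.2.2.trace
      let scal' : ℝ := q.1.trace + q.2.2.trace
      let pairing : ℝ := (∑ i, ∑ j, p.1 i j * q.1 i j) + 2 * (∑ i, ∑ j, p.2.1 i j * q.2.1 i j) +
        ∑ i, ∑ j, p.2.2 i j * q.2.2 i j
      let rmNormSq : ℝ := (∑ i, ∑ j, p.1 i j ^ 2) + 2 * (∑ i, ∑ j, p.2.1 i j ^ 2) +
        ∑ i, ∑ j, p.2.2 i j ^ 2
      let devNormSq : ℝ := rmNormSq - scal ^ 2 / 6
      let margerinP2 : ℝ := scal * (2 * pairing - scal * scal' / 3) - 2 * devNormSq * scal'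
      p.1.IsSymm ∧ p.2.2.IsSymm ∧ p.1.trace ≠ p.2.2.trace ∧ 0 < scal ∧
        devNormSq ≤ c * scal ^ 2 ∧ 0 < margerinP2 := by
  set s : ℝ := min 1 c with hs
  have hs0 : 0 < s := lt_min one_pos hc
  have hs1 : s ≤ 1 := min_le_left _ _
  have hsc : s ≤ c := min_le_right _ _
  refine ⟨((1 + s) • (1 : Matrix (Fin 3) (Fin 3) ℝ), (0 : Matrix (Fin 3) (Fin 3) ℝ),
    (1 : Matrix (Fin 3) (Fin 3) ℝ)), ?_⟩
  dsimp only
  rw [show ((1 + s) • (1 : Matrix (Fin 3) (Fin 3) ℝ), (0 : Matrix (Fin 3) (Fin 3) ℝ),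
      (1 : Matrix (Fin 3) (Fin 3) ℝ)) = ((1 + s) • (1 : Matrix (Fin 3) (Fin 3) ℝ),
      (0 : Matrix (Fin 3) (Fin 3) ℝ), (1 : ℝ) • (1 : Matrix (Fin 3) (Fin 3) ℝ)) by rw [one_smul],
    field_smul_one_pair]
  refine ⟨(Matrix.isSymm_one).smul _, Matrix.isSymm_one, ?_, ?_, ?_, ?_⟩
  · simp [Matrix.trace]
    intro h
    nlinarith [h]
  · simp [Matrix.trace]
    nlinarith
  · simp [Matrix.trace, Matrix.smul_apply, Matrix.one_apply]
    -- `|𝒟|² = (3/2) s²`, `R = 6 + 3 s`; need `(3/2)s² ≤ c (6+3s)²`; since `s² ≤ s ≤ c` and `(6+3s)² ≥ 36`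
    have hss : s ^ 2 ≤ c := by nlinarith
    nlinarith [hss, sq_nonneg s]
  · simp [Matrix.trace, Matrix.smul_apply, Matrix.one_apply]
    -- `P₂ = 54 (1+s) s² > 0`
    nlinarith [hs0, mul_pos hs0 hs0, mul_pos (mul_pos hs0 hs0) hs0]

/-- **No margin — indeed no sign — without the trace identity**: for every `c > 0` and `σ ≥ 0`
the inequality of `stub_margerinPolynomial` fails on `{A, C symmetric, R ≥ 0, |𝒟|² ≤ cR²}`
(the skeleton's `margerinCone c` with `tr A = tr C` deleted). [cite: Margerin1998, Part I, Prop. 4] -/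
theorem no_margerinMargin_without_traceEq (c σ : ℝ) (hc : 0 < c) (hσ : 0 ≤ σ) :
    ¬ (∀ p : HamiltonODE.Blocks,
      let q : HamiltonODE.Blocks := HamiltonODE.field p
      let scal : ℝ := p.1.trace + p.2.2.trace
      let scal' : ℝ := q.1.trace + q.2.2.trace
      let pairing : ℝ := (∑ i, ∑ j, p.1 i j * q.1 i j) + 2 * (∑ i, ∑ j, p.2.1 i j * q.2.1 i j) +
        ∑ i, ∑ j, p.2.2 i j * q.2.2 i j
      let rmNormSq : ℝ := (∑ i, ∑ j, p.1 i j ^ 2) + 2 * (∑ i, ∑ j, p.2.1 i j ^ 2) +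
        ∑ i, ∑ j, p.2.2 i j ^ 2
      let devNormSq : ℝ := rmNormSq - scal ^ 2 / 6
      let margerinP2 : ℝ := scal * (2 * pairing - scal * scal' / 3) - 2 * devNormSq * scal'
      p.1.IsSymm → p.2.2.IsSymm → 0 ≤ scal →
        devNormSq ≤ c * scal ^ 2 → margerinP2 ≤ -(σ * (devNormSq * scal'))) := by
  intro h
  set s : ℝ := min 1 c with hs
  have hs0 : 0 < s := lt_min one_pos hc
  have hs1 : s ≤ 1 := min_le_left _ _
  have hsc : s ≤ c := min_le_right _ _
  have key := h ((1 + s) • (1 : Matrix (Fin 3) (Fin 3) ℝ), (0 : Matrix (Fin 3) (Fin 3) ℝ),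
    (1 : ℝ) • (1 : Matrix (Fin 3) (Fin 3) ℝ)) ((Matrix.isSymm_one).smul _) ((Matrix.isSymm_one).smul _)
  dsimp only at key
  rw [field_smul_one_pair] at key
  simp [Matrix.trace, Matrix.smul_apply, Matrix.one_apply] at key
  have hss : s ^ 2 ≤ c := by nlinarith
  have key2 := key (by nlinarith) (by nlinarith [hss, sq_nonneg s])
  -- key2 : 54(1+s)s² ≤ -σ · ((3/2)s² · (9(1+s)² + 9)), impossible
  nlinarith [key2, mul_pos (mul_pos hs0 hs0) hs0, mul_pos hs0 hs0,
    mul_nonneg hσ (mul_nonneg (sq_nonneg s) (add_nonneg (sq_nonneg (1 + s)) zero_le_one))]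

/-- **`stub_margerinPolynomial` with the trace identity deleted from `margerinCone` is FALSE**
(so any proof of STUB 1 must use `tr A = tr C`, not only the symmetry of `A`, `C`).
[cite: Margerin1998, Part I, Prop. 4] [cite: Hamilton1986, §6, p. 166] -/
theorem stub_margerinPolynomial_false_without_traceEq :
    ¬ (∀ c : ℝ, 0 ≤ c → c < 1 / 6 → ∃ σ : ℝ, 0 < σ ∧ σ ≤ 1 ∧ ∀ p : HamiltonODE.Blocks,
      let q : HamiltonODE.Blocks := HamiltonODE.field p
      let scal : ℝ := p.1.trace + p.2.2.trace
      let scal' : ℝ := q.1.trace + q.2.2.trace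
      let pairing : ℝ := (∑ i, ∑ j, p.1 i j * q.1 i j) + 2 * (∑ i, ∑ j, p.2.1 i j * q.2.1 i j) +
        ∑ i, ∑ j, p.2.2 i j * q.2.2 i j
      let rmNormSq : ℝ := (∑ i, ∑ j, p.1 i j ^ 2) + 2 * (∑ i, ∑ j, p.2.1 i j ^ 2) +
        ∑ i, ∑ j, p.2.2 i j ^ 2
      let devNormSq : ℝ := rmNormSq - scal ^ 2 / 6
      let margerinP2 : ℝ := scal * (2 * pairing - scal * scal' / 3) - 2 * devNormSq * scal'
      (p.1.IsSymm ∧ p.2.2.IsSymm ∧ 0 ≤ scal ∧ devNormSq ≤ c * scal ^ 2) →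
        margerinP2 ≤ -(σ * (devNormSq * scal'))) := by
  intro h
  obtain ⟨σ, hσ, -, hall⟩ := h (1 / 12) (by norm_num) (by norm_num)
  exact no_margerinMargin_without_traceEq (1 / 12) σ (by norm_num) hσ.le
    (fun p h1 h2 h3 h4 ↦ hall p ⟨h1, h2, h3, h4⟩)


/-! ## §B Quantifier order and the size of the margin -/

/-- Local copy of `field_cylinderFamily` (`MargerinMarginBound.lean`):
`field (1, t·1, 1) = ((3 + t²)·1, (2t + 2t²)·1, (3 + t²)·1)`. [cite: Hamilton1986, §6, p. 166] -/
private theorem field_cyl' (t : ℝ) :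
    HamiltonODE.field ((1 : Matrix (Fin 3) (Fin 3) ℝ), t • (1 : Matrix (Fin 3) (Fin 3) ℝ),
        (1 : Matrix (Fin 3) (Fin 3) ℝ)) =
      ((3 + t ^ 2) • (1 : Matrix (Fin 3) (Fin 3) ℝ), (2 * t + 2 * t ^ 2) • (1 : Matrix (Fin 3) (Fin 3) ℝ),
        (3 + t ^ 2) • (1 : Matrix (Fin 3) (Fin 3) ℝ)) := by
  simp only [HamiltonODE.field]
  rw [sharp_smul_one3]
  have h1 : (1 : Matrix (Fin 3) (Fin 3) ℝ).sharp = 1 := by simp [Matrix.sharp]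
  rw [h1]
  refine Prod.ext ?_ (Prod.ext ?_ ?_)
  · ext i j
    fin_cases i <;> fin_cases j <;>
      simp [Matrix.smul_apply] <;> ring
  · ext i j
    fin_cases i <;> fin_cases j <;>
      simp [Matrix.smul_apply] <;> ring
  · ext i j
    fin_cases i <;> fin_cases j <;>
      simp [Matrix.smul_apply] <;> ring

/-- Local copy of `margerinMargin_le` (`MargerinMarginBound.lean`, drefute gen 1): on the cone `c = t²/6` any
admissible margin satisfies `σ ≤ 2(1 − t)²/(3 + t²)` (witness `(1, t·1, 1)`). [cite: Margerin1998, Part I, Lemma 9] -/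
private theorem margin_le' (t σ : ℝ) (ht0 : 0 < t)
    (h : ∀ p : HamiltonODE.Blocks,
      let q : HamiltonODE.Blocks := HamiltonODE.field p
      let scal : ℝ := p.1.trace + p.2.2.trace
      let scal' : ℝ := q.1.trace + q.2.2.trace
      let pairing : ℝ := (∑ i, ∑ j, p.1 i j * q.1 i j) + 2 * (∑ i, ∑ j, p.2.1 i j * q.2.1 i j) +
        ∑ i, ∑ j, p.2.2 i j * q.2.2 i j
      let rmNormSq : ℝ := (∑ i, ∑ j, p.1 i j ^ 2) + 2 * (∑ i, ∑ j, p.2.1 i j ^ 2) +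
        ∑ i, ∑ j, p.2.2 i j ^ 2
      let devNormSq : ℝ := rmNormSq - scal ^ 2 / 6
      let margerinP2 : ℝ := scal * (2 * pairing - scal * scal' / 3) - 2 * devNormSq * scal'
      p.1.IsSymm → p.2.2.IsSymm → p.1.trace = p.2.2.trace → 0 ≤ scal →
        devNormSq ≤ t ^ 2 / 6 * scal ^ 2 → margerinP2 ≤ -(σ * (devNormSq * scal'))) :
    σ ≤ 2 * (1 - t) ^ 2 / (3 + t ^ 2) := by
  have key := h ((1 : Matrix (Fin 3) (Fin 3) ℝ), t • (1 : Matrix (Fin 3) (Fin 3) ℝ),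
    (1 : Matrix (Fin 3) (Fin 3) ℝ))
  dsimp only at key
  rw [field_cyl'] at key
  simp [Matrix.trace, Matrix.smul_apply, Matrix.one_apply, Matrix.isSymm_one] at key
  have ht2 : 0 < t ^ 2 := by positivity
  have key2 := key (by linarith)
  rw [le_div_iff₀ (by positivity)]
  nlinarith [key2, ht2, mul_pos ht2 ht2]

/-- **No uniform margin on the open cone `WP < 1/6`** (the pointwise shadow of Margerin's remark that
`β`-weak pinching is preserved only on `WP ≤ 1/6 − δ`, Lemma 9): there is no single `σ > 0` serving
every sub-cone `c < 1/6` in `stub_margerinPolynomial` — by `margerinMargin_le`, `σ(c) ≤ 2(1−√(6c))²/(3+6c) → 0`.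
So the order of quantifiers `∀ c, ∃ σ` in STUB 1 cannot be reversed. [cite: Margerin1998, Part I, Lemma 9 (p. 34)] -/
theorem no_uniform_margerinMargin :
    ¬ (∃ σ : ℝ, 0 < σ ∧ ∀ c : ℝ, 0 ≤ c → c < 1 / 6 → ∀ p : HamiltonODE.Blocks,
      let q : HamiltonODE.Blocks := HamiltonODE.field p
      let scal : ℝ := p.1.trace + p.2.2.trace
      let scal' : ℝ := q.1.trace + q.2.2.trace
      let pairing : ℝ := (∑ i, ∑ j, p.1 i j * q.1 i j) + 2 * (∑ i, ∑ j, p.2.1 i j * q.2.1 i j) +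
        ∑ i, ∑ j, p.2.2 i j * q.2.2 i j
      let rmNormSq : ℝ := (∑ i, ∑ j, p.1 i j ^ 2) + 2 * (∑ i, ∑ j, p.2.1 i j ^ 2) +
        ∑ i, ∑ j, p.2.2 i j ^ 2
      let devNormSq : ℝ := rmNormSq - scal ^ 2 / 6
      let margerinP2 : ℝ := scal * (2 * pairing - scal * scal' / 3) - 2 * devNormSq * scal'
      p.1.IsSymm → p.2.2.IsSymm → p.1.trace = p.2.2.trace → 0 ≤ scal →
        devNormSq ≤ c * scal ^ 2 → margerinP2 ≤ -(σ * (devNormSq * scal'))) := by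
  rintro ⟨σ, hσ, h⟩
  -- the cylinder-family member with `t = 1 - u`, `u = min (1/2) σ`, lies in the sub-cone `c = t²/6 < 1/6`
  set u : ℝ := min (1 / 2) σ with hu
  have hu0 : 0 < u := lt_min (by norm_num) hσ
  have hu1 : u ≤ 1 / 2 := min_le_left _ _
  have huσ : u ≤ σ := min_le_right _ _
  set t : ℝ := 1 - u with ht
  have ht0 : 0 < t := by rw [ht]; linarith
  have ht1 : t < 1 := by rw [ht]; linarith
  have hc0 : 0 ≤ t ^ 2 / 6 := by positivity
  have hc1 : t ^ 2 / 6 < 1 / 6 := by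
    have : t ^ 2 < 1 := by nlinarith
    linarith
  have hle := margin_le' t σ ht0 (h (t ^ 2 / 6) hc0 hc1)
  -- `σ ≤ 2u²/(3+t²) ≤ 2u²/3 ≤ u/3 < σ`
  rw [le_div_iff₀ (by positivity)] at hle
  have h1 : (1 - t) = u := by rw [ht]; ring
  rw [h1] at hle
  have h3 : 3 * σ ≤ σ * (3 + t ^ 2) := by nlinarith [sq_nonneg t, hσ.le]
  have h4 : 2 * u ^ 2 ≤ u := by nlinarith [hu0.le, hu1]
  linarith [huσ]


/-- **No margin linear in the gap `1/6 − c`**: for every `κ > 0` the choice `σ(c) = κ·(1/6 − c)` fails in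
`stub_margerinPolynomial` for `c` close to `1/6` — the true margin vanishes QUADRATICALLY,
`σ(c) ≤ 2(1−√(6c))²/(3+6c) ≈ (9/2)(1/6 − c)²` (`margerinMargin_le`). Information for a reshape of STUB 1 with an
explicit `σ(c)`: it must be `O((1/6 − c)²)`. [cite: Margerin1998, Part I, Lemma 9 (p. 34)] -/
theorem no_linear_margerinMargin (κ : ℝ) (hκ : 0 < κ) :
    ¬ (∀ c : ℝ, 0 ≤ c → c < 1 / 6 → ∀ p : HamiltonODE.Blocks,
      let q : HamiltonODE.Blocks := HamiltonODE.field p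
      let scal : ℝ := p.1.trace + p.2.2.trace
      let scal' : ℝ := q.1.trace + q.2.2.trace
      let pairing : ℝ := (∑ i, ∑ j, p.1 i j * q.1 i j) + 2 * (∑ i, ∑ j, p.2.1 i j * q.2.1 i j) +
        ∑ i, ∑ j, p.2.2 i j * q.2.2 i j
      let rmNormSq : ℝ := (∑ i, ∑ j, p.1 i j ^ 2) + 2 * (∑ i, ∑ j, p.2.1 i j ^ 2) +
        ∑ i, ∑ j, p.2.2 i j ^ 2
      let devNormSq : ℝ := rmNormSq - scal ^ 2 / 6
      let margerinP2 : ℝ := scal * (2 * pairing - scal * scal' / 3) - 2 * devNormSq * scal'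
      p.1.IsSymm → p.2.2.IsSymm → p.1.trace = p.2.2.trace → 0 ≤ scal →
        devNormSq ≤ c * scal ^ 2 → margerinP2 ≤ -(κ * (1 / 6 - c) * (devNormSq * scal'))) := by
  intro h
  set u : ℝ := min (1 / 2) (κ / 12) with hu
  have hu0 : 0 < u := lt_min (by norm_num) (by positivity)
  have hu1 : u ≤ 1 / 2 := min_le_left _ _
  have huκ : u ≤ κ / 12 := min_le_right _ _
  set t : ℝ := 1 - u with ht
  have ht0 : 0 < t := by rw [ht]; linarith
  have hc0 : 0 ≤ t ^ 2 / 6 := by positivity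
  have hc1 : t ^ 2 / 6 < 1 / 6 := by
    have : t ^ 2 < 1 := by nlinarith
    linarith
  have hle := margin_le' t (κ * (1 / 6 - t ^ 2 / 6)) ht0 (h (t ^ 2 / 6) hc0 hc1)
  rw [le_div_iff₀ (by positivity)] at hle
  have h1 : (1 - t) = u := by rw [ht]; ring
  have h1' : 1 / 6 - t ^ 2 / 6 = u * (2 - u) / 6 := by rw [ht]; ring
  rw [h1, h1'] at hle
  -- hle : κ * (u(2-u)/6) * (3 + t²) ≤ 2u²; but the left side is ≥ κ·(u·(3/2)/6)·3 = (3/4)κu ≥ 9u² > 2u²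
  have h2 : 3 ≤ 3 + t ^ 2 := by nlinarith [sq_nonneg t]
  have h3 : 3 / 2 ≤ 2 - u := by linarith
  have h4 : κ * (u * (3 / 2) / 6) * 3 ≤ κ * (u * (2 - u) / 6) * (3 + t ^ 2) := by
    apply mul_le_mul _ h2 (by norm_num) (by positivity)
    apply mul_le_mul_of_nonneg_left _ hκ.le
    apply div_le_div_of_nonneg_right _ (by norm_num)
    exact mul_le_mul_of_nonneg_left h3 hu0.le
  have h5 : 12 * u ≤ κ := by linarith
  nlinarith [hle, h4, h5, hu0, mul_pos hu0 hu0]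

/-! ## §C The `B`-odd part of `P₂` -/

/-- **The `B`-odd part of Margerin's `P₂` is `24·R·det B`**: `P₂(A,−B,C) − P₂(A,B,C) = −48·(tr A + tr C)·det B`
for every block triple. [cite: Margerin1998, Part I, Lemma 5 (p. 29)] -/
theorem margerinP2_reflectB_sub (p : HamiltonODE.Blocks) :
    (let p' : HamiltonODE.Blocks := HamiltonODE.reflectB p
     let q : HamiltonODE.Blocks := HamiltonODE.field p'
     let scal : ℝ := p'.1.trace + p'.2.2.trace
     let scal' : ℝ := q.1.trace + q.2.2.trace
     let pairing : ℝ := (∑ i, ∑ j, p'.1 i j * q.1 i j) + 2 * (∑ i, ∑ j, p'.2.1 i j * q.2.1 i j) +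
       ∑ i, ∑ j, p'.2.2 i j * q.2.2 i j
     let rmNormSq : ℝ := (∑ i, ∑ j, p'.1 i j ^ 2) + 2 * (∑ i, ∑ j, p'.2.1 i j ^ 2) +
       ∑ i, ∑ j, p'.2.2 i j ^ 2
     let devNormSq : ℝ := rmNormSq - scal ^ 2 / 6
     scal * (2 * pairing - scal * scal' / 3) - 2 * devNormSq * scal') -
    (let q : HamiltonODE.Blocks := HamiltonODE.field p
     let scal : ℝ := p.1.trace + p.2.2.trace
     let scal' : ℝ := q.1.trace + q.2.2.trace
     let pairing : ℝ := (∑ i, ∑ j, p.1 i j * q.1 i j) + 2 * (∑ i, ∑ j, p.2.1 i j * q.2.1 i j) +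
       ∑ i, ∑ j, p.2.2 i j * q.2.2 i j
     let rmNormSq : ℝ := (∑ i, ∑ j, p.1 i j ^ 2) + 2 * (∑ i, ∑ j, p.2.1 i j ^ 2) +
       ∑ i, ∑ j, p.2.2 i j ^ 2
     let devNormSq : ℝ := rmNormSq - scal ^ 2 / 6
     scal * (2 * pairing - scal * scal' / 3) - 2 * devNormSq * scal') =
    -(48 * (p.1.trace + p.2.2.trace) * p.2.1.det) := by
  obtain ⟨A, B, C⟩ := p
  -- Hamilton's field at the reflected triple: only the `B`-equation changes, `B' ↦ -(AB + BC - 2B^#)`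
  have hq : HamiltonODE.field (HamiltonODE.reflectB (A, B, C)) =
      (A * A + B * Bᵀ + (2 : ℝ) • A.sharp, -(A * B + B * C - (2 : ℝ) • B.sharp),
        C * C + Bᵀ * B + (2 : ℝ) • C.sharp) := by
    have h2 := congrArg HamiltonODE.reflectB (HamiltonODE.reflectB_field_reflectB (A, B, C))
    rw [HamiltonODE.reflectB_reflectB] at h2
    rw [h2]
    simp [HamiltonODE.reflectB]
  have hp : HamiltonODE.field (A, B, C) =
      (A * A + B * Bᵀ + (2 : ℝ) • A.sharp, A * B + B * C + (2 : ℝ) • B.sharp,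
        C * C + Bᵀ * B + (2 : ℝ) • C.sharp) := rfl
  -- `⟨B, B^#⟩ = 3 det B` (cofactor expansion along the three rows)
  have hdet : ∑ i, ∑ j, B i j * B.sharp i j = 3 * B.det := by
    simp only [Matrix.sharp, Matrix.adjugate_fin_three, Matrix.det_fin_three, Matrix.transpose_apply,
      Matrix.of_apply, Fin.sum_univ_three]
    simp
    ring
  dsimp only
  rw [hq, hp]
  simp only [HamiltonODE.reflectB]
  -- freeze the even blocks of the field as atoms
  generalize A * A + B * Bᵀ + (2 : ℝ) • A.sharp = X
  generalize C * C + Bᵀ * B + (2 : ℝ) • C.sharp = Z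
  generalize hY : A * B + B * C = Y
  have hsum1 : ∑ i, ∑ j, (-B) i j * (-(Y - (2 : ℝ) • B.sharp)) i j =
      (∑ i, ∑ j, B i j * Y i j) - 2 * ∑ i, ∑ j, B i j * B.sharp i j := by
    simp only [Matrix.neg_apply, Matrix.sub_apply, Matrix.smul_apply, smul_eq_mul, neg_mul_neg, mul_sub,
      Finset.sum_sub_distrib, Finset.mul_sum]
    ring_nf
  have hsum2 : ∑ i, ∑ j, B i j * (Y + (2 : ℝ) • B.sharp) i j =
      (∑ i, ∑ j, B i j * Y i j) + 2 * ∑ i, ∑ j, B i j * B.sharp i j := by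
    simp only [Matrix.add_apply, Matrix.smul_apply, smul_eq_mul, mul_add, Finset.sum_add_distrib,
      Finset.mul_sum]
    ring_nf
  have hsq : ∑ i, ∑ j, (-B) i j ^ 2 = ∑ i, ∑ j, B i j ^ 2 := by simp
  rw [hsum1, hsum2, hsq, hdet]
  ring

end Summit.SmoothPoincare4.SmoothPoincare4.Theorems.ChangGurskyYang.Negative

end
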